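import Summits.QuantumFields.YangMills.Theses.AspectPurityFloor
import Summits.QuantumFields.YangMills.Theorems.LuscherReductionRunningReductionTraceFormula
import Summits.QuantumFields.YangMills.Theorems.ThermalTraceWindowFewBodyEntropyRungFixedL
import Summits.QuantumFields.YangMills.Theorems.FemtoTransferGapLevelsDecay
import HarnessLib

/-!
# `AspectPurityFloor.ParticipationDoor` (stmt-QuantumFields-23745) PROVED, and the fixed-lattice PURITY-FLOOR RUNG (BC5 witness for `WindowPurityFloor` 23743 / `TailPurityFloor` 23742)

* `participation_door` : for `β ≥ 1`, `L ≥ 4`, `t = ⌊L/2⌋`: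
  `Z_phys(L×L³) ≤ (1 + Z_phys(t×L³)²/Z_phys(2t×L³) · √((λ₁/λ₀)^L)) · λ₀^L`  (exact trace-formula algebra).
* `physTrace_le_poly_mul_levelValue_zero_pow_of_le` : `Z_phys(T×L³) ≤ C_L β^{12L³} λ₀^T` for every `2 ≤ T` (the landed
  fixed-L rung, freed from `T = L`).
* `purityFloor_fixedL` : for every fixed `L ≥ 4`: `Z_phys(t×L³)² ≤ C_L² β^{24L³} · Z_phys(2t×L³)` for all `β ≥ 1` — the
  fixed-lattice shadow (first rung) of the cruxes `WindowPurityFloor` / `TailPurityFloor`.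
No RG content; no summit; the Yang–Mills mass gap is not proved here.
-/

noncomputable section

open MeasureTheory Filter Topology Real
open Literature.MathematicalPhysics.QuantumLattice
open Literature.MathematicalPhysics.QuantumFieldTheory hiding SU2
open Summit.QuantumFields.YangMills.Theorems
open Summit.QuantumFields.YangMills.Theorems.FemtoTransferGap

namespace Summit.QuantumFields.YangMills.Theses.AspectPurityFloor

/-- **PARTICIPATION DOOR.** [cite: ReedSimonIV1978, Thm. XIII.1] [cite: MontvayMunster1994, (3.145)] -/
theorem participation_door (L : ℕ) [NeZero L] (β : ℝ) (hβ : 1 ≤ β) (hL : 4 ≤ L) :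
    TT.physTrace L β L ≤
      (1 + TT.physTrace L β (L / 2) ^ 2 / TT.physTrace L β (2 * (L / 2)) *
        Real.sqrt ((levelValue su2Rep L β 1 / levelValue su2Rep L β 0) ^ L)) * levelValue su2Rep L β 0 ^ L := by
  have hβ0 : 0 < β := by linarith
  set t : ℕ := L / 2 with ht
  have ht2 : 2 ≤ t := by omega
  have htL : t ≤ L := by omega
  have h2Lt : L ≤ 2 * (L - t) := by omega
  set lam : ℕ → ℝ := fun k => levelValue su2Rep L β k with hlam
  have hl0 : 0 < lam 0 := levelValue_zero_su2Rep_pos L β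
  have hlpos : ∀ k, 0 < lam k := fun k => levelValue_su2Rep_pos hβ0 k
  have hanti : ∀ {j k : ℕ}, j ≤ k → lam k ≤ lam j := fun hjk => levelValue_le_of_le hβ0 hjk
  -- trace formulas at `t`, `2t`, `L`
  have hSt : HasSum (fun k => lam k ^ t) (TT.physTrace L β t) := TT.traceFormula_all L β t hβ ht2
  have hS2t : HasSum (fun k => lam k ^ (2 * t)) (TT.physTrace L β (2 * t)) :=
    TT.traceFormula_all L β (2 * t) hβ (by omega)
  have hSL : HasSum (fun k => lam k ^ L) (TT.physTrace L β L) := TT.traceFormula_all L β L hβ (by omega)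
  set Zt : ℝ := TT.physTrace L β t with hZt
  set Z2t : ℝ := TT.physTrace L β (2 * t) with hZ2t
  set ZL : ℝ := TT.physTrace L β L with hZL
  have hZ2t_ge : lam 0 ^ (2 * t) ≤ Z2t :=
    le_hasSum hS2t 0 (fun j _ => pow_nonneg (hlpos j).le _)
  have hZ2t_pos : 0 < Z2t := lt_of_lt_of_le (pow_pos hl0 _) hZ2t_ge
  have hZt_ge : lam 0 ^ t ≤ Zt := le_hasSum hSt 0 (fun j _ => pow_nonneg (hlpos j).le _)
  have hZt_pos : 0 < Zt := lt_of_lt_of_le (pow_pos hl0 _) hZt_ge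
  -- (1) `Z(2t) ≤ λ₀^t Z(t)`
  have h1 : Z2t ≤ lam 0 ^ t * Zt := by
    have hg : HasSum (fun k => lam 0 ^ t * lam k ^ t) (lam 0 ^ t * Zt) := hSt.mul_left _
    refine hasSum_le (fun k => ?_) hS2t hg
    have hsq : lam k ^ (2 * t) = lam k ^ t * lam k ^ t := by rw [two_mul, pow_add]
    rw [hsq]
    exact mul_le_mul_of_nonneg_right (pow_le_pow_left₀ (hlpos k).le (hanti (Nat.zero_le k)) _)
      (pow_nonneg (hlpos k).le _)
  -- (2) `Z(L) ≤ λ₀^L + λ₁^{L-t} Z(t)`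
  have h2 : ZL ≤ lam 0 ^ L + lam 1 ^ (L - t) * Zt := by
    have hg1 : HasSum (fun k : ℕ => if k = 0 then lam 0 ^ L else 0) (lam 0 ^ L) := hasSum_ite_eq 0 _
    have hg2 : HasSum (fun k => lam 1 ^ (L - t) * lam k ^ t) (lam 1 ^ (L - t) * Zt) := hSt.mul_left _
    have hg := hg1.add hg2
    refine hasSum_le (fun k => ?_) hSL hg
    rcases Nat.eq_zero_or_pos k with hk | hk
    · subst hk
      simp only [if_true]
      have hnn : 0 ≤ lam 1 ^ (L - t) * lam 0 ^ t := mul_nonneg (pow_nonneg (hlpos 1).le _) (pow_nonneg hl0.le _)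
      linarith
    · have hk0 : k ≠ 0 := by omega
      simp only [hk0, if_false, zero_add]
      have hsplit : lam k ^ L = lam k ^ (L - t) * lam k ^ t := by rw [← pow_add]; congr 1; omega
      rw [hsplit]
      exact mul_le_mul_of_nonneg_right (pow_le_pow_left₀ (hlpos k).le (hanti (by omega)) _)
        (pow_nonneg (hlpos k).le _)
  -- (3) the ratio `r = λ₁/λ₀ ∈ [0,1]`, `λ₁^{L-t} = λ₀^{L-t} r^{L-t}`, `r^{L-t} ≤ √(r^L)`
  set r : ℝ := lam 1 / lam 0 with hr
  have hr0 : 0 ≤ r := div_nonneg (hlpos 1).le hl0.le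
  have hr1 : r ≤ 1 := (div_le_one hl0).2 (hanti (by norm_num))
  have hlam1 : lam 1 = lam 0 * r := by rw [hr]; field_simp
  have hpow1 : lam 1 ^ (L - t) = lam 0 ^ (L - t) * r ^ (L - t) := by rw [hlam1, mul_pow]
  have hr_sqrt : r ^ (L - t) ≤ Real.sqrt (r ^ L) := by
    have hsq : r ^ (L - t) = Real.sqrt ((r ^ (L - t)) ^ 2) := (Real.sqrt_sq (pow_nonneg hr0 _)).symm
    rw [hsq]
    apply Real.sqrt_le_sqrt
    rw [← pow_mul]
    exact pow_le_pow_of_le_one hr0 hr1 (by omega)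
  -- (4) `Z(t)/λ₀^t ≤ Z(t)²/Z(2t)`
  have hl0t : 0 < lam 0 ^ t := pow_pos hl0 _
  have h4 : Zt / lam 0 ^ t ≤ Zt ^ 2 / Z2t := by
    rw [div_le_div_iff₀ hl0t hZ2t_pos, sq, mul_assoc]
    exact mul_le_mul_of_nonneg_left (by linarith [h1]) hZt_pos.le
  -- (5) combine
  have hmain : lam 1 ^ (L - t) * Zt ≤ Zt ^ 2 / Z2t * Real.sqrt (r ^ L) * lam 0 ^ L := by
    have hLsplit : lam 0 ^ L = lam 0 ^ (L - t) * lam 0 ^ t := by rw [← pow_add]; congr 1; omega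
    have hZt_eq : Zt = Zt / lam 0 ^ t * lam 0 ^ t := by field_simp
    calc lam 1 ^ (L - t) * Zt = lam 0 ^ (L - t) * r ^ (L - t) * (Zt / lam 0 ^ t * lam 0 ^ t) := by
          rw [hpow1, ← hZt_eq]
      _ = (Zt / lam 0 ^ t) * r ^ (L - t) * (lam 0 ^ (L - t) * lam 0 ^ t) := by ring
      _ ≤ (Zt ^ 2 / Z2t) * Real.sqrt (r ^ L) * (lam 0 ^ (L - t) * lam 0 ^ t) := by
          apply mul_le_mul_of_nonneg_right _ (by positivity)
          exact mul_le_mul h4 hr_sqrt (pow_nonneg hr0 _) (by positivity)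
      _ = Zt ^ 2 / Z2t * Real.sqrt (r ^ L) * lam 0 ^ L := by rw [hLsplit]
  calc ZL ≤ lam 0 ^ L + lam 1 ^ (L - t) * Zt := h2
    _ ≤ lam 0 ^ L + Zt ^ 2 / Z2t * Real.sqrt (r ^ L) * lam 0 ^ L := by linarith [hmain]
    _ = (1 + Zt ^ 2 / Z2t * Real.sqrt (r ^ L)) * lam 0 ^ L := by ring

/-- **Few-body at fixed lattice, every Euclidean time `T ≥ 2`**: `Z_phys(T×L³) ≤ C_L β^{12L³} λ₀(β,L)^T` for `β ≥ 1`
(the landed rung `ThermalTraceWindow.physTrace_le_poly_mul_levelValue_zero_pow`, with `T` freed from `L`).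
[cite: Luscher1983, §2] [cite: MontvayMunster1994, (3.145)] -/
theorem physTrace_le_poly_mul_levelValue_zero_pow_of_le (L : ℕ) [NeZero L] :
    ∃ C q : ℝ, 0 < C ∧ ∀ (T : ℕ), 2 ≤ T → ∀ β : ℝ, 1 ≤ β →
      TT.physTrace L β T ≤ C * β ^ q * levelValue su2Rep L β 0 ^ T := by
  set E : ℕ := Fintype.card (Edge 3 L) with hE
  set K : ℝ := (4 / (Real.exp (-(1 / 2 : ℝ)) * (8 / (3 * π ^ 3)))) ^ E / uniformFloorConst L with hK
  have hcL : 0 < uniformFloorConst L := uniformFloorConst_pos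
  have hKpos : 0 < K := by positivity
  refine ⟨K ^ 2, ((4 * E : ℕ) : ℝ), by positivity, fun T hT β hβ => ?_⟩
  have hβ0 : 0 < β := by linarith
  rw [Real.rpow_natCast]
  set lam0 : ℝ := levelValue su2Rep L β 0 with hlam0
  have hl0 : 0 < lam0 := levelValue_zero_su2Rep_pos L β
  set M : ℝ := K * β ^ (2 * E) * lam0 with hM
  have hKM : ∀ U V : GaugeConfig 3 L FemtoTransferGap.SU2, transferKernel su2Rep β U V ≤ M := fun U V =>
    ThermalTraceWindow.transferKernel_le_poly_mul_levelValue_zero L hβ U V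
  have hHS : ∀ k : ℕ, ∑ j ∈ Finset.range (k + 1), levelValue su2Rep L β j ^ 2 ≤ M ^ 2 := fun k => by
    rw [Finset.sum_range]
    exact sum_levelValue_sq_le (L := L) hβ0 hKM k
  have hterm : ∀ k : ℕ, levelValue su2Rep L β k ^ T ≤ lam0 ^ (T - 2) * levelValue su2Rep L β k ^ 2 := fun k => by
    have hk0 : 0 ≤ levelValue su2Rep L β k := (levelValue_su2Rep_pos hβ0 k).le
    have hk : levelValue su2Rep L β k ≤ lam0 := levelValue_le_of_le hβ0 (Nat.zero_le k)
    have hsplit : levelValue su2Rep L β k ^ T = levelValue su2Rep L β k ^ (T - 2) * levelValue su2Rep L β k ^ 2 := by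
      rw [← pow_add]; congr 1; omega
    rw [hsplit]
    exact mul_le_mul_of_nonneg_right (pow_le_pow_left₀ hk0 hk _) (sq_nonneg _)
  have hS := TT.traceFormula_all L β T hβ hT
  have hbound : ∀ s : Finset ℕ, ∑ k ∈ s, levelValue su2Rep L β k ^ T ≤ lam0 ^ (T - 2) * M ^ 2 := fun s => by
    have hsub : s ⊆ Finset.range (s.sup id + 1) := fun i hi =>
      Finset.mem_range.2 (Nat.lt_succ_of_le (Finset.le_sup (f := id) hi))
    calc ∑ k ∈ s, levelValue su2Rep L β k ^ T ≤ ∑ k ∈ s, lam0 ^ (T - 2) * levelValue su2Rep L β k ^ 2 :=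
          Finset.sum_le_sum fun k _ => hterm k
      _ ≤ ∑ k ∈ Finset.range (s.sup id + 1), lam0 ^ (T - 2) * levelValue su2Rep L β k ^ 2 :=
          Finset.sum_le_sum_of_subset_of_nonneg hsub fun k _ _ => by positivity
      _ = lam0 ^ (T - 2) * ∑ k ∈ Finset.range (s.sup id + 1), levelValue su2Rep L β k ^ 2 := by rw [Finset.mul_sum]
      _ ≤ lam0 ^ (T - 2) * M ^ 2 := mul_le_mul_of_nonneg_left (hHS _) (pow_nonneg hl0.le _)
  have hZ : TT.physTrace L β T ≤ lam0 ^ (T - 2) * M ^ 2 := hasSum_le_of_sum_le hS hbound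
  have hfin : lam0 ^ (T - 2) * M ^ 2 = K ^ 2 * β ^ (4 * E) * lam0 ^ T := by
    rw [hM]
    have hT2 : T = (T - 2) + 2 := by omega
    conv_rhs => rw [hT2]
    rw [pow_add, show 4 * E = 2 * (2 * E) from by ring, pow_mul]
    ring
  exact hZ.trans_eq hfin

/-- **PURITY FLOOR AT FIXED LATTICE (BC5 rung of `WindowPurityFloor`/`TailPurityFloor`).** For every `L ≥ 4` there are
`C, q` with `Z_phys(⌊L/2⌋×L³)² ≤ C β^q Z_phys(2⌊L/2⌋×L³)` for all `β ≥ 1`: the participation ratio of the zero-flux thermal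
state at aspect ½ is polynomial in `β` at fixed lattice size.  [cite: Luscher1983, §2] [cite: MontvayMunster1994, (3.145)] -/
theorem purityFloor_fixedL (L : ℕ) [NeZero L] (hL : 4 ≤ L) :
    ∃ C q : ℝ, 0 < C ∧ ∀ β : ℝ, 1 ≤ β →
      TT.physTrace L β (L / 2) ^ 2 ≤ C * β ^ q * TT.physTrace L β (2 * (L / 2)) := by
  obtain ⟨C, q, hC, hall⟩ := physTrace_le_poly_mul_levelValue_zero_pow_of_le L
  refine ⟨C ^ 2, 2 * q, by positivity, fun β hβ => ?_⟩
  have hβ0 : 0 < β := by linarith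
  set t : ℕ := L / 2 with ht
  have ht2 : 2 ≤ t := by omega
  have hl0 : 0 < levelValue su2Rep L β 0 := levelValue_zero_su2Rep_pos L β
  have hup : TT.physTrace L β t ≤ C * β ^ q * levelValue su2Rep L β 0 ^ t := hall t ht2 β hβ
  have hS2t : HasSum (fun k => levelValue su2Rep L β k ^ (2 * t)) (TT.physTrace L β (2 * t)) :=
    TT.traceFormula_all L β (2 * t) hβ (by omega)
  have hlow : levelValue su2Rep L β 0 ^ (2 * t) ≤ TT.physTrace L β (2 * t) :=
    le_hasSum hS2t 0 (fun j _ => pow_nonneg (levelValue_su2Rep_pos hβ0 j).le _)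
  have hZt0 : 0 ≤ TT.physTrace L β t :=
    (pow_nonneg hl0.le t).trans (le_hasSum (TT.traceFormula_all L β t hβ ht2) 0
      (fun j _ => pow_nonneg (levelValue_su2Rep_pos hβ0 j).le _))
  have hβq : 0 ≤ β ^ q := Real.rpow_nonneg hβ0.le q
  calc TT.physTrace L β t ^ 2 ≤ (C * β ^ q * levelValue su2Rep L β 0 ^ t) ^ 2 :=
        pow_le_pow_left₀ hZt0 hup 2
    _ = C ^ 2 * (β ^ q) ^ 2 * levelValue su2Rep L β 0 ^ (2 * t) := by ring
    _ = C ^ 2 * β ^ (2 * q) * levelValue su2Rep L β 0 ^ (2 * t) := by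
        rw [show (β ^ q) ^ 2 = β ^ (2 * q) from by rw [mul_comm, Real.rpow_mul hβ0.le, Real.rpow_two]]
    _ ≤ C ^ 2 * β ^ (2 * q) * TT.physTrace L β (2 * t) :=
        mul_le_mul_of_nonneg_left hlow (by positivity)

/-- **Route item `AspectPurityFloor.ParticipationDoor` (stmt-QuantumFields-23745), proved.** -/
theorem participationDoor_holds : ParticipationDoor :=
  fun L _ β hβ hL => participation_door L β hβ hL

end Summit.QuantumFields.YangMills.Theses.AspectPurityFloor

end
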